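import Summits.QuantumFields.YangMills.Theorems.BalabanLadderUVSeamRecClassicalResponseThermalFloorSplit
import Summits.QuantumFields.YangMills.Theorems.BalabanLadderUVSeamRecResponseMomentsPinning
import HarnessLib

/-!
# Crux `UVSeamRec` (stmt-QuantumFields-20043): the REGISTERED stub (RM) cannot be witnessed with a constant reference value —
# the thermal floor on the torus and seam-s2's pinning lemma

Helper file (`--supports stmt-QuantumFields-20043`) of the LEAD seat `ym-spine-20043-p1` (gen 10), part 4 of the «thermal floor» files; sequel of
`…ClassicalResponseThermalFloor` (`kerE_deficit_ge`: `6/(24β+3) ≤ kerE^η_β(2 − plane q x)` for EVERY exterior), `…ThermalFloorSplit` (the window lemma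
`exists_admissible_scale_below_floor`) and of seam-s2's `…ResponseMomentsPinning` ((RM) ⇒ `|⟨plane q x⟩_{2L+1,β} − p q β| ≤ C₁(e^B − 1)/R⁴`).

The registered v5(α) stub `stub_responseMomentsOdd6 : UV → (RM)` (`ResponseMomentsDefs.ResponseMomentsOdd6SU2`) quantifies
`∃ (a c C₁ B β₁ ℓ₁ P₀) (p : Fin 4 × Fin 4 → ℝ → ℝ), …`: the reference values `p q β` may depend on the coupling but not on the torus or the radius.
WHAT IS PROVED here (all `SU(2)`, fundamental representation):
* `torusE_plane_le` — on every odd torus `2L+1 ≥ 5` and for every `β ≥ 0`: `⟨plane q x⟩_{2L+1,β} ≤ 2 − 6/(24β+3)` (torus DLR for the radius-1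
  kernel, seam-s2's `torusE_plane_eq_torusE_kerE`, and part 2's all-exterior thermal floor);
* **`responseMoments_ref_le`** — the (RM) inequality family at unit `a` with constants `(C₁ > 0, B, β₁, ℓ₁)` and reference `p` (seam-s2's `hRM`
  binder VERBATIM) forces `p q β ≤ 2 − 6/(24β+3) + C₁(e^B − 1)/R⁴` for `β ≥ β₁`, `β ≥ 0`, `1 ≤ R`, `R·a β ≤ ℓ₁` (any torus `4R+8 ≤ L` witnesses it);
* **`not_responseMomentsWindow_const_two`** — for every unit map `a` with `a ≤ c·uRec` eventually (`c > 0`), every `ℓ₁ > 0`, `C₁ > 0`, `B`, `β₁`: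
  the (RM) family with the CONSTANT reference `p ≡ 2` is FALSE (the window `R ≤ ℓ₁/(c·uRec β)` grows like `e^{β/(4b₀)}`, so the tolerance
  `C₁(e^B − 1)/R⁴` drops below the thermal floor `6/(24β+3)`);
* **`responseMomentsOdd6SU2_body_const_two_false`** — the same read on the REGISTERED text: the conjunction under the `∃` of
  `ResponseMomentsOdd6SU2` with `p := fun _ _ => 2` is FALSE for every choice of the other seven witnesses.

READING (numbers).  Any prover of `stub_responseMomentsOdd6` must supply reference values with `2 − P₀ ≤ p q β ≤ 2 − 6/(24β+3) + o(1)` — the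
β-dependent plaquette mean (perturbatively `2 − 3/(4β) + …` in tree units), pinned to `O((c·uRec β/ℓ₁)⁴)`; seam-s2's pinning gave the two-sided
`O(R⁻⁴)` pin to the torus mean, this file adds the explicit `Θ(1/β)` offset from `N` that no admissible `p` can ignore.  HONEST FRAMING: a NECESSARY
CONDITION on the ∃-witness of an OPEN registered stub; not a refutation of the stub; nothing of E0′, NT or the gap; not Clay.
-/

set_option autoImplicit false

noncomputable section

open MeasureTheory Filter Topology
open Literature.MathematicalPhysics.QuantumFieldTheory (LatticeRep)
open Literature.MathematicalPhysics.QuantumLattice (LGConfig fundamentalLatticeRep)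
open Summit.QuantumFields.YangMills.Cruxes.OSLegsFromFemtoAndGap.DlrCollarTransfer
open Summit.QuantumFields.YangMills.Cruxes.UVSeamRec.ResponsePinning (torusE_plane_eq_torusE_kerE torusE_mono torusE_const
  abs_torusE_plane_sub_le_of_responseMoments)
open Summit.QuantumFields.YangMills.Cruxes.UVSeamRec.TemperedResponse (continuous_kerE_plane)

namespace Summit.QuantumFields.YangMills.Cruxes.UVSeamRec.ClassicalResponse.ThermalFloor

/-- **The torus plaquette mean stays `Θ(1/β)` below `N = 2`**: on every odd torus `(ℤ/(2L+1))⁴` with `L ≥ 2`, for every `β ≥ 0`, orientation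
`q.1 < q.2` and site `x`, `⟨plane q x⟩_{2L+1,β} ≤ 2 − 6/(24β+3)` (torus DLR for the radius-1 cube kernel around `x` and the all-exterior thermal floor
`kerE_deficit_ge`). [folklore] -/
theorem torusE_plane_le {β : ℝ} (hβ : 0 ≤ β) {L : ℕ} (hL : 2 ≤ L) (q : Fin 4 × Fin 4) (hq : q.1 < q.2) (x : Fin 4 → ℤ) :
    torusE (Matrix.specialUnitaryGroup (Fin 2) ℂ) (fundamentalLatticeRep 2) β L
        (plane (Matrix.specialUnitaryGroup (Fin 2) ℂ) (fundamentalLatticeRep 2) q x) ≤ 2 - 6 / (24 * β + 3) := by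
  rw [torusE_plane_eq_torusE_kerE (fundamentalLatticeRep 2) β q x 0 L (by omega)]
  have hpt : ∀ η : LGConfig 4 (Matrix.specialUnitaryGroup (Fin 2) ℂ),
      kerE (Matrix.specialUnitaryGroup (Fin 2) ℂ) (fundamentalLatticeRep 2) β (fun k => x k - (0 + 1)) (2 * 0 + 3) η
        (plane (Matrix.specialUnitaryGroup (Fin 2) ℂ) (fundamentalLatticeRep 2) q x) ≤ 2 - 6 / (24 * β + 3) := by
    intro η
    have h := kerE_deficit_ge hβ 0 q hq x η
    rw [kerE_const_sub (fundamentalLatticeRep 2) β _ _ η (continuous_plane (fundamentalLatticeRep 2) q x)] at h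
    push_cast at h ⊢
    linarith
  have hmono := torusE_mono (fundamentalLatticeRep 2) β L (continuous_kerE_plane (fundamentalLatticeRep 2) β _ _ q x)
    continuous_const hpt
  rwa [torusE_const] at hmono

/-- **(RM) pins its reference value below `N − Θ(1/β)`.**  Under the response-moment family at unit `a` with constants `C₁ > 0`, `B`, `β₁`, `ℓ₁`
and reference `p` (seam-s2's `hRM` binder VERBATIM, `SU(2)` fundamental): for `β ≥ β₁`, `β ≥ 0`, `1 ≤ R`, `R·a β ≤ ℓ₁` and every orientation,
`p q β ≤ 2 − 6/(24β+3) + C₁(e^B − 1)/R⁴` (pinning to the torus mean on the torus `L = 4R+8`, plus `torusE_plane_le`). [folklore] -/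
theorem responseMoments_ref_le (a : ℝ → ℝ) {C₁ B β₁ ℓ₁ : ℝ} {p : Fin 4 × Fin 4 → ℝ → ℝ} (hC₁ : 0 < C₁)
    (hRM : ∀ β : ℝ, β₁ ≤ β → ∀ (L n : ℕ) (q : Fin n → Fin 4 × Fin 4) (x : Fin n → (Fin 4 → ℤ)) (R : ℕ),
      (∀ i, (q i).1 < (q i).2) → 1 ≤ R → (R : ℝ) * a β ≤ ℓ₁ → 4 * R + 8 ≤ L →
      (∀ i j : Fin n, i ≠ j → ∃ k : Fin 4,
        (2 * (R : ℤ) + 4) ≤ |((((x i k - x j k : ℤ) : ZMod (2 * L + 1))).valMinAbs : ℤ)|) →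
      ∀ T : Finset (Fin n),
        torusE (Matrix.specialUnitaryGroup (Fin 2) ℂ) (fundamentalLatticeRep 2) β L
          (fun U => Real.exp (∑ i ∈ T, (R : ℝ) ^ 4 / C₁ *
            |kerE (Matrix.specialUnitaryGroup (Fin 2) ℂ) (fundamentalLatticeRep 2) β
              (fun k => x i k - (R + 1)) (2 * R + 3) U
              (plane (Matrix.specialUnitaryGroup (Fin 2) ℂ) (fundamentalLatticeRep 2) (q i) (x i)) -
              p (q i) β|)) ≤ Real.exp (B * T.card))
    {β : ℝ} (hβ₁ : β₁ ≤ β) (hβ : 0 ≤ β) {R : ℕ} (hR : 1 ≤ R) (hRa : (R : ℝ) * a β ≤ ℓ₁) (q : Fin 4 × Fin 4) (hq : q.1 < q.2) :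
    p q β ≤ 2 - 6 / (24 * β + 3) + C₁ * (Real.exp B - 1) / (R : ℝ) ^ 4 := by
  have h1 := abs_torusE_plane_sub_le_of_responseMoments (fundamentalLatticeRep 2) a hC₁ hRM hβ₁ (L := 4 * R + 8) q 0 hq hR hRa le_rfl
  have h2 := torusE_plane_le hβ (L := 4 * R + 8) (by omega) q hq 0
  have h3 := (abs_le.1 h1).1
  linarith

/-- **THE CONSTANT REFERENCE IS INADMISSIBLE FOR (RM).**  For every unit map `a` dominated by the unit of record (`a β ≤ c·uRec β` eventually,
`c > 0`), every `ℓ₁ > 0`, `C₁ > 0`, `B` and `β₁`, the response-moment family with `p ≡ 2 = N` is FALSE: along the window `R ≤ ℓ₁/(c·uRec β)` the pinning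
tolerance `C₁(e^B − 1)/R⁴` falls below the thermal floor `6/(24β+3)` (`exists_admissible_scale_below_floor`, i.e. `β·uRec(β)⁴ → 0`). [folklore] -/
theorem not_responseMomentsWindow_const_two (a : ℝ → ℝ) {c C₁ B β₁ ℓ₁ : ℝ} (hc : 0 < c) (ha : ∀ᶠ β in atTop, a β ≤ c * Transport.uRec β)
    (hℓ₁ : 0 < ℓ₁) (hC₁ : 0 < C₁) :
    ¬ (∀ β : ℝ, β₁ ≤ β → ∀ (L n : ℕ) (q : Fin n → Fin 4 × Fin 4) (x : Fin n → (Fin 4 → ℤ)) (R : ℕ),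
      (∀ i, (q i).1 < (q i).2) → 1 ≤ R → (R : ℝ) * a β ≤ ℓ₁ → 4 * R + 8 ≤ L →
      (∀ i j : Fin n, i ≠ j → ∃ k : Fin 4,
        (2 * (R : ℤ) + 4) ≤ |((((x i k - x j k : ℤ) : ZMod (2 * L + 1))).valMinAbs : ℤ)|) →
      ∀ T : Finset (Fin n),
        torusE (Matrix.specialUnitaryGroup (Fin 2) ℂ) (fundamentalLatticeRep 2) β L
          (fun U => Real.exp (∑ i ∈ T, (R : ℝ) ^ 4 / C₁ *
            |kerE (Matrix.specialUnitaryGroup (Fin 2) ℂ) (fundamentalLatticeRep 2) β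
              (fun k => x i k - (R + 1)) (2 * R + 3) U
              (plane (Matrix.specialUnitaryGroup (Fin 2) ℂ) (fundamentalLatticeRep 2) (q i) (x i)) -
              (fun (_ : Fin 4 × Fin 4) (_ : ℝ) => (2 : ℝ)) (q i) β|)) ≤ Real.exp (B * T.card)) := by
  intro hRM
  obtain ⟨βa, hβa⟩ := Filter.eventually_atTop.1 ha
  have hℓc : 0 < ℓ₁ / c := div_pos hℓ₁ hc
  -- an admissible `(β, R)` in the window `R · uRec β ≤ ℓ₁/c` below the floor, for the tolerance `M := max (C₁(e^B − 1)) 0`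
  obtain ⟨β, R, hβ0, hβ1, hR1, hRu, hlt⟩ :=
    exists_admissible_scale_below_floor hℓc (le_max_right (C₁ * (Real.exp B - 1)) 0) (max β₁ βa)
  have hβ₁ : β₁ ≤ β := (le_max_left _ _).trans hβ0
  have hβa' : βa ≤ β := (le_max_right _ _).trans hβ0
  have hRa : (R : ℝ) * a β ≤ ℓ₁ := by
    have h1 : (R : ℝ) * a β ≤ (R : ℝ) * (c * Transport.uRec β) := mul_le_mul_of_nonneg_left (hβa β hβa') (by positivity)
    have h2 : (R : ℝ) * (c * Transport.uRec β) = c * ((R : ℝ) * Transport.uRec β) := by ring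
    have h3 : c * ((R : ℝ) * Transport.uRec β) ≤ c * (ℓ₁ / c) := mul_le_mul_of_nonneg_left hRu hc.le
    rw [mul_div_cancel₀ _ hc.ne'] at h3
    linarith
  have href := responseMoments_ref_le a (p := fun (_ : Fin 4 × Fin 4) (_ : ℝ) => (2 : ℝ)) hC₁ hRM hβ₁ (by linarith) hR1 hRa (0, 1)
    (by decide)
  have hRpos : (0 : ℝ) < (R : ℝ) ^ 4 := by positivity
  have hmax : C₁ * (Real.exp B - 1) / (R : ℝ) ^ 4 ≤ max (C₁ * (Real.exp B - 1)) 0 / (R : ℝ) ^ 4 :=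
    div_le_div_of_nonneg_right (le_max_left _ _) hRpos.le
  linarith

/-- **Read on the REGISTERED text.**  The conjunction under the `∃` of `ResponseMomentsDefs.ResponseMomentsOdd6SU2` (= the body of the v5(α) stub
`stub_responseMomentsOdd6`, skeleton afcf556d5b76a240) with the reference values specialised to the constant `p := fun _ _ => 2` is FALSE for every
choice of the remaining witnesses `a, c, C₁, B, β₁, ℓ₁, P₀`: any closer of the stub must supply β-dependent reference values (the plaquette means).
[folklore] -/
theorem responseMomentsOdd6SU2_body_const_two_false (a : ℝ → ℝ) (c C₁ B β₁ ℓ₁ P₀ : ℝ) :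
    ¬ (0 < c ∧ (∀ᶠ β in atTop, a β ≤ c * Transport.uRec β) ∧ 0 < ℓ₁ ∧ 0 < C₁ ∧
      (∀ (q : Fin 4 × Fin 4) (β : ℝ), |(fun (_ : Fin 4 × Fin 4) (_ : ℝ) => (2 : ℝ)) q β| ≤ P₀) ∧
      ∀ β : ℝ, β₁ ≤ β → ∀ (L n : ℕ) (q : Fin n → Fin 4 × Fin 4) (x : Fin n → (Fin 4 → ℤ)) (R : ℕ),
      (∀ i, (q i).1 < (q i).2) → 1 ≤ R → (R : ℝ) * a β ≤ ℓ₁ → 4 * R + 8 ≤ L →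
      (∀ i j : Fin n, i ≠ j → ∃ k : Fin 4,
        (2 * (R : ℤ) + 4) ≤ |((((x i k - x j k : ℤ) : ZMod (2 * L + 1))).valMinAbs : ℤ)|) →
      ∀ T : Finset (Fin n),
        torusE (Matrix.specialUnitaryGroup (Fin 2) ℂ) (fundamentalLatticeRep 2) β L
          (fun U => Real.exp (∑ i ∈ T, (R : ℝ) ^ 4 / C₁ *
            |kerE (Matrix.specialUnitaryGroup (Fin 2) ℂ) (fundamentalLatticeRep 2) β
              (fun k => x i k - (R + 1)) (2 * R + 3) U
              (plane (Matrix.specialUnitaryGroup (Fin 2) ℂ) (fundamentalLatticeRep 2) (q i) (x i)) -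
              (fun (_ : Fin 4 × Fin 4) (_ : ℝ) => (2 : ℝ)) (q i) β|)) ≤ Real.exp (B * T.card)) := by
  rintro ⟨hc, ha, hℓ₁, hC₁, -, hRM⟩
  exact not_responseMomentsWindow_const_two a hc ha hℓ₁ hC₁ hRM

end Summit.QuantumFields.YangMills.Cruxes.UVSeamRec.ClassicalResponse.ThermalFloor

end
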